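import Mathlib
import HarnessLib
import HarnessLib.Audit
import Summits.KontsevichZagierPeriods.Statement
import Literature.NumberTheory.Transcendental.KZRegCalculus
import HarnessLib.Audit.Status.Attr

/-!
Route: Deregularisation

DORMANT since 2026-08-23T16:03:52Z (reconciler: no traction for 6.1 d (last activity item-proof-filed at 2026-08-17T12:53:53Z); parked, not closed — `ledger route dormant route-KontsevichZagierPeriods-Deregularisation --off` to reactiva) — unstaffed, not closed; items shared with open routes are served there. `ledger route dormant <id> --off` reactivates.

# Route Deregularisation — de-regularise log-corner move chains; the regularisation content of
double shuffle is one shear defect between convergent rational reps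

Card realised: log-corner-deregularisation-functor (spine). Posit KZreg = the Dupont–Panzer–Pym
regularised calculus restricted to
ℚ-semialgebraic corner data (log-divergent semialgebraic integrands on corner charts, rational
tangential data; moves = DPP's change of
variables, Fubini, regularised Stokes) and the additive DE-REGULARISATION map Λ : KZreg.FormalRep →+
KZ.FormalRep (stratified finite part by
subtraction in a product collar of each divergence face, anomaly terms ∫dv/v for changes of
tangential data). X = X1 ∧ X2:
X1 (RegConservative) Λ maps KZreg-relations into
`Literature.NumberTheory.Transcendental.KZ.relations` and Λ∘incl = id;
X2 (RegKernel2 — REPAIRED 2026-08-16, item stmt-KontsevichZagierPeriods-14491) every vanishing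
ℤ-combination of CONVERGENT representations is the de-regularisation Λ d of a KZreg-relation d, i.e.
ker KZ.eval ≤ Λ(KZreg.relations); the naive kernel form `KZreg.eval d = 0 → d ∈ KZreg.relations`
first written for X2 is REFUTED in tree (`KZreg.not_kernelConjecture`: the unit pole [(0,1),
dt/(1−t); {0}] has regularised value 0 but residue 1, and the four v1 moves preserve the residue
functional `KZreg.res`) and is used nowhere in the route. X2 is summit-strength — X1 ∧ X2 ⟺
Conjecture 1 (`KZreg.conservative_and_ker_le_iff` with ker Λ = defects,
`kzKernelConjecture_iff_isRational`), and Conjecture 1 implies X1 and X2 separately — and it is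
carried OPENLY as the route's own rank-9 crux, not as a Literature conjecture (none is assumed); the
route's work is X1. This session's analysis sharpens X1: Λ is conservative
BY BOOKKEEPING on additivity and on face-preserving product changes of variables, and the 1-dim
anomaly log φ'(0) is paid by moves
(AnomalyDimOne); the whole content of X1 on the Ihara–Kaneko–Zagier derivations sits in ONE kind of
instance, the u-dependent SHEAR
x₁ ↦ u·x₁ of a corner chart, whose Λ-image is the explicit convergent identity
ScalingDefectPrinciple (typed today; weight-4 instance
ScalingDefectWeightFour, equivalent modulo bookkeeping moves to Hoffman's relation ζ(4) = ζ(3,1) +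
ζ(2,2)).
Lean: `(∀ (n : ℕ) (G : (Fin (n + 1) → ℝ) → ℝ) (r r' :
Literature.NumberTheory.Transcendental.KZ.IntegralRep (n + 2)), MeasureTheory.IntegrableOn G {x | ∀
i, x i ∈ Set.Ioo (0:ℝ) 1} → r.domain = {t | (∀ i, t i ∈ Set.Ioo (0:ℝ) 1) ∧ t 0 < t 1} → Set.EqOn
r.integrand (fun t => G (Fin.tail t) / (1 - t 0)) r.domain → r'.domain = {t | ∀ i, t i ∈ Set.Ioo
(0:ℝ) 1} → Set.EqOn r'.integrand (fun t => (G (Fin.tail t) - t 0 * G (Function.update (Fin.tail t) 0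
(t 0 * t 1))) / (1 - t 0)) r'.domain → Literature.NumberTheory.Transcendental.KZ.Equivalent r r') ∧
(∃ (L : Type) (_ : AddCommGroup L) (rel : AddSubgroup L) (ev : L →+ ℝ) (ι :
Literature.NumberTheory.Transcendental.KZ.FormalRep →+ L) (Λ : L →+
Literature.NumberTheory.Transcendental.KZ.FormalRep), (∀ c, Λ (ι c) = c) ∧ (∀ c, ev (ι c) =
Literature.NumberTheory.Transcendental.KZ.eval c) ∧ (∀ d, ev d = 0 → d ∈ rel) ∧ (∀ d ∈ rel, Λ d ∈
Literature.NumberTheory.Transcendental.KZ.relations))`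

## Assembly
Pure algebra (proved as `assembly_holds` in Sketch.lean, the card's argument): for rational r, r'
with equal values put c = [r] − [r'];
ev(ι c) = eval c = 0, so ι c ∈ rel (RegKernel2, instance rel := KZreg.relations ⊔ ker Λ), so c = Λ(ι
c) ∈ Λ(rel) ⊆ KZ.relations (RegConservative2). The cruxes enter through the
INSTANCE: RegConservative for L := KZreg implies ScalingDefectPrinciple (hence
ScalingDefectWeightFour, hence HoffmanWeightFour by
DefectToHoffman) because A_G − B_G is the Λ-image of a three-move KZreg chain (additivity, shear
change of variables, domain additivity);
conversely the typed cruxes are necessary conditions of the summit (A, B rational with equal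
values), so their refutation refutes it.

Rationale: WHY THIS LINE. Most printed derivations of MZV / associator / formality identities pass through
log-divergent integrals (ζ(1)-regularisation in
IharaKanekoZagier2006, tangential base points in Brown2012, cut-offs), which the H21 calculus
forbids (every IntegralRep is absolutely
integrable): route Neg names this pressure point (a) and route Grothendieck assumes it away (item
0277, DoubleShuffleInKZ). DupontPanzerPym2026
(Thm/Def 1.5, Cor 7.9–7.11, Prop 7.15) prove that regularised integration on manifolds with log
corners obeys exactly KZ's three laws, so a
regularised derivation is a chain in a larger calculus KZreg, and the stratified finite part Λ
(prototype: the forest subtraction of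
BrownKreimer2013 Thm 60, which turns log-divergent parametric forms into convergent ones) maps it
back to KZ. Working the smallest case by hand
(ζ(1)·ζ(3); Soudères' cubical blow-up and Cartier's identity for the stuffle, Souderes2010 §1.3)
shows where the functor is NOT free: additivity
and u-independent changes of variables commute with Λ on the nose, the anomaly is a 1-dim change of
variables on ∫dv/v, and the single
u-dependent shear x₁ ↦ u x₁ linking the shuffle chart to the stuffle chart has Λ-defect A − B, two
RATIONAL convergent 4-dim reps with the same
value Σ_N H_N/N³ whose KZ-equivalence is Hoffman's weight-4 relation in disguise. Imported: log
geometry / regularised de Rham theory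
(DPP), parametric renormalisation (Brown–Kreimer), M_{0,n} blow-up combinatorics (Soudères,
BrownENS2009); no probabilistic or spectral
reformulation applies. New versus prior routes: ExpConservative enlarges the VALUES (Γ, exponential
periods) and its conservativity is a
transcendence-flavoured statement; here no new numbers enter (Λ-images are convergent semialgebraic
reps) and conservativity is pinned to an
explicit typed family; versus Grothendieck 0275/0277 this route supplies the mechanism and the exact
residual statement instead of a hypothesis.

RANKED CRUXES. #0 DeregularisationShell (target) — typed shell of X: there is an additive
"regularised calculus" (L, rel, ev) over KZ.FormalRep with a section ι and a retraction Λ (Λ∘ι = id,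
ev∘ι = eval) such that ker ev ≤ rel (RegKernel) and Λ(rel) ≤ KZ.relations (RegConservative). For
unconstrained L this is equivalent to `Literature.NumberTheory.Transcendental.KZKernelConjecture`
(take L := FormalRep; `shell_of_kernel` in Sketch.lean); the route's content is the INSTANCE L :=
KZreg.FormalRep (definition request) — do not attack the shell directly; it is closed by RegKernel ∧
RegConservative for KZreg (informal cruxes filed after open). (why it might fail: Equivalent to
KZKernelConjecture for unconstrained L, hence at least as strong as the summit; the intended
instance KZreg may be too small a calculus (regularised Stokes with semialgebraic primitives only)
for RegKernel.) [DupontPanzerPym2026, KontsevichZagier2001, HuberMullerStach2017]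
#2 ScalingDefectWeightFour (crux) — the Λ-defect of the shear (u,x) ↦ (u,ux) in the de-regularised
IKZ derivation for ζ(1)·ζ(3): the rational reps A = [{(u,x,y,z) ∈ (0,1)⁴ : u < x}, 1/((1−u)(1−xyz))]
and B = [(0,1)⁴, 1/((1−uxyz)(1−xyz))] (both absolutely convergent, both of value Σ_N H_N/N³ =
ζ(4)+ζ(3,1) = 5ζ(4)/4) are KZ-equivalent. Modulo eight bookkeeping moves (DefectToHoffman) this IS
Hoffman's weight-4 relation; card items (d) Λ∘CoV − CoV∘Λ and (e) calibration. [difficulty: L] (why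
it might fail: All printed proofs expand Σ_{N≥M} 1/(MN³) in series or integrate by parts with
polylog primitives (fibre primitive −log(1−xyz)/(yz): barrier noSemialgebraicPrimitive); a finite
chain in (0,1)⁴ may not exist — then an additive invariant separating A from B refutes the summit.)
[IharaKanekoZagier2006, Hoffman1992, DupontPanzerPym2026, Souderes2010,
Literature.Barriers.KontsevichZagierPeriods.noSemialgebraicPrimitive_inv_sub_two]
#3 ScalingDefectPrinciple (crux) — RegConservative on shears, typed: for every G ∈ L¹((0,1)^{n+1}),
A_G = [{u < x₁} × (0,1)^n, G(x)/(1−u)] and B_G = [(0,1)^{n+2}, (G(x) − u·G(u x₁, x₂, …))/(1−u)] are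
KZ-equivalent whenever both are integral representations (values agree by Fubini; G ∈ L¹ is
necessary: G = 1/x₁ gives ζ(2) versus 0, the Dupont–Panzer–Pym anomaly ∫ log u du/(1−u)). With G =
Soudères' cubical MZV integrand f_s this family is IKZ's "EDS with ζ(1)" (Thm 2 (v), m = 1), which
with finite double shuffle conjecturally exhausts all MZV relations (IKZ statement (3), checked to
weight 16). [deps: ScalingDefectWeightFour] [difficulty: open-problem] (why it might fail: Uniform
proof exists only where G has a semialgebraic x₁-primitive (two Newton–Leibniz moves); from G =
1/(1−x₁⋯xₙ) on it contains every Hoffman-type relation; a single L¹ counterexample (additive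
invariant) kills it and the summit together.) [DupontPanzerPym2026, IharaKanekoZagier2006,
BrownKreimer2013, KontsevichZagier2001]
#4 HoffmanWeightFour (crux) — Hoffman's relation in weight 4 inside the calculus: for the simplex
reps Z4 = [Δ⁴, ω₀ω₀ω₀ω₁], Z31 = [Δ⁴, ω₀ω₀ω₁ω₁], Z22 = [Δ⁴, ω₀ω₁ω₀ω₁] (same domain literal as
Grothendieck 0275), [Z4] − [Z31] − [Z22] ∈ KZ.relations. The smallest MZV relation born from
regularisation: not in the ℚ-span of finite double shuffle + duality (weight 4: five symbols, three
relations, true dimension 1; IKZ §2–3); card calibration (e). [deps: ScalingDefectWeightFour]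
[difficulty: L] (why it might fail: Known proofs use ζ(1)-regularisation (IKZ Thm 1), Euler's
evaluations through π, or series rearrangement (Hoffman 1992 Thm 5.1, sum formula); equivalent mod
bookkeeping to ScalingDefectWeightFour, so it stands or falls with the shear defect unless a
π-detour chain exists.) [Hoffman1992, IharaKanekoZagier2006, Souderes2010, Brown2012,
KontsevichZagier2001]
#9 DefectToHoffman (support) — the bookkeeping half of the de-regularised IKZ derivation at weight
4, all on convergent reps: A ≡ Z22 + 2·Z31 (cubical-to-simplicial change of variables (u,x,y,z) ↦
(u,x,xy,xyz), domain additivity of {u < s₁} by the position of u, three coordinate permutations) and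
B ≡ Z31 + Z4 (integrand additivity 1/((1−uw)(1−w)) = w/((1−w)(1−uw)) + 1/(1−uw), w = xyz, Soudères'
Prop. 1.3 changes of variables); hence ScalingDefectWeightFour → HoffmanWeightFour. Lean-heavy (side
conditions of ~8 move instances), no new idea. [difficulty: L] [Souderes2010, KontsevichZagier2001]
#9 AnomalyDimOne (support) — the one-dimensional Dupont–Panzer–Pym anomaly is paid by moves: for f
continuous at 0⁺ and a ℚ-semialgebraic strictly increasing φ : [0,1] → [0,1], φ(0)=0, φ(1)=1,
differentiable on (0,1), right derivative c > 0 at 0, the finite parts Λ(reg∫₀¹ f dx/x) = [(0,1),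
(f(x)−f(0))/x] and Λ of its φ-reparametrisation [(0,1), f(φ(y))φ'(y)/φ(y) − f(0)/y] differ in
KZ.relations exactly by the log rep [(0,1), f(0)(c−1)/(1+(c−1)v)] (value f(0)·log c). Expected
chain: change of variables x = φ(y), integrand additivity, then [(0,1), f(0)ψ'/ψ] with ψ = φ(y)/y ↦
change of variables z = ψ(y) on monotonicity cells of ψ (o-minimal cell decomposition), domain
additivity. [difficulty: M] [DupontPanzerPym2026, KontsevichZagier2001]

TWO-LAYER PLAN. ScalingDefectPrinciple ⇐ PrimitiveCase (G with a semialgebraic x₁-primitive: two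
Newton–Leibniz moves) → CubicalMZVCase (G = f_s) →
ScalingDefectPrinciple; RegConservative (informal) ⇐ ScalingDefectPrinciple → AnomalyInFamilies
(AnomalyDimOne over a semialgebraic base)
→ RegStokesConservative; HoffmanWeightFour ⇐ ScalingDefectWeightFour → DefectToHoffman (already
filed). k ≤ 3, depth 1; nothing filed now.

KILL CRITERIA. An additive invariant of the four move sets separating A from B
(¬ScalingDefectWeightFour) closes the route as a positive line
(close refuted:ScalingDefectWeightFour) AND refutes KontsevichZagierPeriods outright (A, B are
rational reps with equal values) — hand the
witness to route Neg as its first concrete regularisation witness. A proof of HoffmanWeightFour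
through π (Euler evaluations) without the
shear defect does not kill but demotes the mechanism to "one of two roads". If the KZreg definition
shows that DPP's regularised Stokes needs
non-semialgebraic primitives as data, RegConservative is re-posed over the shear/anomaly family only
(pivot: thesis := ScalingDefectPrinciple
∧ FDS bookkeeping ⇒ MZV sector, composed with Grothendieck's ZagierConjecture). Grothendieck 0275
(ζ(4)=4ζ(3,1)) refuted ⇒ close (finite
double shuffle already fails, regularisation moot).

NOT DECOMPOSED YET. Deeper corners: ζ(1)^m·ζ(s) with m ≥ 2, where IKZ's comparison ρ (Γ-series A(u),
T-degree ≥ 2) must be matched by iterated constant terms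
on a depth-2 corner — the first place where "regularisation is a choice" bites; associator /
KZ-equation derivations (Furusho2011) and
Kontsevich formality weights (DPP's own target); Λ on non-normal-crossing divergence loci (needs the
M̄_{0,n} dihedral blow-up charts,
BrownENS2009, BrownCarrSchneps2010); the all-weight Hoffman family as one Lean statement over
`KZ.mzvRep` (list combinatorics); the
negations ¬ScalingDefectWeightFour as a staffed item (refuters may prove negations of the filed
items directly).

CHEAPEST FALSIFIER. (i) Lookup: an integral-calculus proof (changes of variables + Stokes on
convergent integrals only) of ζ(4) = ζ(3,1) + ζ(2,2) or of
∫_{(0,1)³} log(1−x)/(1−xyz) = ∫_{(0,1)³} log(1−xyz)/(xyz(1−xyz)) — searched Eie2008 (App. B: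
shuffle-type and weighted sum formulas by
log-integrals, the stuffle is imported from series), Borwein–Bradley-type Euler-sum evaluations
(polylog primitives), Markarian
arXiv:2008.00855 and BrownCarrSchneps2010 (finite stuffle geometric; regularised double shuffle =
geometric relations is their OPEN conjecture):
none found; a hit would make rank 2 `known` and the route a transcription job. (ii) Already run by
hand: values of A and B both equal
Σ_N H_N/N³ = 5ζ(4)/4 (termwise the same series), and the degenerate case G = 1/x₁ (values ζ(2) vs 0)
which forced the L¹ hypothesis.

NUMBERS. Weight 4: generators ζ(4), ζ(3,1), ζ(2,2), ζ(2,1,1) (+ the product rep ζ(2)ζ(2)); finite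
double shuffle gives ζ(4) = 4ζ(3,1), duality
ζ(2,1,1) = ζ(4), Hoffman/EDS ζ(4) = ζ(3,1) + ζ(2,2) (IharaKanekoZagier2006 §2, p. 313); d₄ = 1
(Zagier; proven upper bound Brown2012 /
Terasoma). value(A) = value(B) = Σ_{N≥M≥1} 1/(M N³) = ζ(4) + ζ(3,1) = 5ζ(4)/4 = π⁴/72 ≈ 1.352904.
IKZ statement (3) "FDS + EDS with ζ(1)"
verified to weight 16, statement (4) fails at weight 13 (IKZ p. 315). Items at open: 7 (1 target, 3
cruxes, 2 support, 1 assembly); after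
open: 2 informal cruxes (RegConservative rank 5, EDSInKZreg rank 6), 1 informal support (RegKernel),
1 definition request (KZreg, Λ).

DEFINITION REQUESTS. KZreg (Summits side, like KZexp): reps = (ℚ-semialgebraic corner chart domain,
integrand = semialgebraic / ∏(distance to divergence faces),
rational tangential data per face); FormalRep, eval := DPP regularised integral (DupontPanzerPym2026
Thm/Def 1.5, Ex. 7.13 in coordinates),
moves := additivity ×2, change of variables with anomaly term (Cor 7.9 + §1.1), regularised
Newton–Leibniz/Stokes (Cor 7.11), incl from KZ
(Prop 7.15: absolutely convergent ⇒ regularised = ordinary); Λ : FormalRep_log →+ KZ.FormalRep =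
product-collar subtraction with zero
extension (this route's normal form; n = 1: ∫(f − f(0))/x + f(0)·[log rep]). Cite facts wanted: DPP
Thm/Def 1.5, Cor 7.9–7.11, Prop 7.15;
IKZ Thm 1 and Thm 2 (v).

Novelty: Searches (2026-08-15): `lit read doi:10.5802/jep.335` (pp. 3–10, 49–58: Thm/Def 1.5, Cor 7.9–7.11,
Prop 7.15, Ex 7.13, §1.2.6 "we expect
[log periods] equals the ring of ordinary periods"); `lit search --source zbmath "parametric
renormalization Brown Kreimer"` (2) → `lit read
arxiv:1112.1180` (Thm 40/60); `lit search --source zbmath "Soudères motivic double shuffle"` (1) →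
`lit read arxiv:0808.0248` §1.3;
`lit search --hybrid "Hoffman relation multiple zeta values integral proof"` (12; Eie2008 App. B
read pp. 143–149); `lit galaxy search
"regularized double shuffle" --star pdf` (7; Markarian 2008.00855 read, Glanois thesis, Goncharov
math/0202154); `lit vsearch` (noise);
`lit read doi:10.1112/S0010437X0500182X` (IKZ pp. 4–9, 18); OpenAlex/arXiv APIs rate-limited today,
`--star all` queue saturated (logged).
Nearest prior art found: DupontPanzerPym2026 (the regularised calculus and its three laws; values
are "logarithmic periods", equality with
KZ periods only expected); BrownKreimer2013 Thm 60 (forest-formula subtraction after blow-ups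
renders log-divergent parametric forms
convergent — the prototype of Λ, for Feynman graphs, values only); Souderes2010 §1.3 / Cartier
(finite stuffle = blow-up change of variables
+ partial fractions, i.e. moves); Markarian arXiv:2008.00855 and BrownCarrSchneps2010 (geometric
relations of convergent cell-zeta values;
that they are equivalent to REGULARISED double shuffle is stated as an open conjecture);
IharaKanekoZagier2006 (EDS analytically  [refs: 10.5802/jep.335`, 10.1112/S0010437X0500182X`, 10.1142/7036, 1112.1180, 0808.0248, 2008.00855, doi:10.5802/jep.335, arxiv:1112.1180, arxiv:0808.0248, doi:10.1112/S0010437X0500182X, doi:10.1142/7036, DupontPanzerPym2026, BrownKreimer2013, Souderes2010, BrownCarrSchneps2010, IharaKanekoZagier2006]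

Barriers (technique_class: deregularisation, shear-defect, blowup-cov): - technique_class: deregularisation, shear-defect, blowup-cov
- Literature.Barriers.KontsevichZagierPeriods.noSemialgebraicPrimitive_inv_sub_two: APPLIES with
full force and is not evaded by a one-variable trick: the shear defects are two Newton–Leibniz moves
exactly when G has a semialgebraic x₁-primitive, and the first hard instance G = 1/(1−xyz) has fibre
primitive −log(1−xyz)/(yz); the bet is a genuinely 4-dimensional chain (blow-ups of (0,1)⁴, i.e.
symmetries of M̄_{0,7} beyond duality) — or a refutation, equally informative (Neg witness).
- Literature.Barriers.KontsevichZagierPeriods.kzConjecture_implies_oddZetaAlgIndep: applies only to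
the summit-ward hypothesis RegKernel / DeregularisationShell (≥ KZKernelConjecture, conceded); the
typed cruxes assert no transcendence — they are necessary conditions of the summit of fixed shape
whose two sides have equal values by Fubini.
- Literature.Barriers.KontsevichZagierPeriods.kzConjecture_implies_twoPiI_log_algIndep: same as the
previous line (summit-strength barrier, carried by RegKernel only).
- Literature.Barriers.KontsevichZagierPeriods.kzConjecture_implies_ellipticPeriods_algIndep: same
(MZV sector only; no elliptic periods enter).
- Literature.Barriers.KontsevichZagierPeriods.cressonViuSos_prop_3_2: not engaged — every dissection
used is a semialgebraic cell decomposition inside one chart; no volume-preserving homeomorphism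
between non-PL-equivalent bodies is invoked.
- Literature.Barriers.KontsevichZagierPeriods.not_com

History (route lifecycle, newest last):
- 2026-08-15T11:28:59Z · rev 1: dropped RegConservative, EDSInKZlog, RegKernel — rename the posited calculus KZlog -> KZreg: notion name KZlog is already taken by defn-KZlog (log-MONOMIAL calculus of route LiouvilleUnfolding, a different obj (planner-plancard-KontsevichZagierPeriods-Kont-dfae1a47-0)
- 2026-08-15T11:41:29Z · rev 3: dropped stmt-KontsevichZagierPeriods-4102, stmt-KontsevichZagierPeriods-4112, stmt-KontsevichZagierPeriods-4117 — drop by item id the three superseded informal items (KZlog naming); their verbatim successors with the KZreg name are stmt-4952 (RegConservative2), stmt-4953 (E (planner-plancard-KontsevichZagierPeriods-Kont-dfae1a47-0)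
- 2026-08-16T02:17:47Z · AUTO-CRUX: 2 conjecture-grade item(s) promoted to crux (DeregularisationShell, RegKernel2) — refuter vetting / tiering apply (operator:999:1362873)
- 2026-08-16T03:46:37Z · AUTO-CRUX (edit): DeregularisationShell — hypotheses of the deciding theorem that nothing in the route derives are cruxes (planner-rconj-KontsevichZagierPeriods-Deregul-c9ee0eed-0)
- 2026-08-23T16:03:52Z · DORMANT — reconciler: no traction for 6.1 d (last activity item-proof-filed at 2026-08-17T12:53:53Z); parked, not closed — `ledger route dormant route-KontsevichZagierPer (operator:999:931932)

sub-problem: KontsevichZagierPeriods · status: dormant · opened planner-plancard-KontsevichZagierPeriods-Kont-dfae1a47-0 2026-08-15T11:25:50Z · rev 10 · ledger route-KontsevichZagierPeriods-Deregularisation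
GENERATED by the gate from the ledger (D-0016/17). Provers cite these decls: `theorem foo : Summit.KontsevichZagierPeriods.KontsevichZagierPeriods.Theses.Deregularisation.<Decl> := …` in Summits/KontsevichZagierPeriods/KontsevichZagierPeriods/Theorems/<Name>.lean.
-/

namespace Summit.KontsevichZagierPeriods.KontsevichZagierPeriods.Theses.Deregularisation

open scoped BigOperators Topology Manifold Classical MeasureTheory ProbabilityTheory Matrix InnerProductSpace ComplexConjugate ContinuousMap
open Filter Set Function TopologicalSpace MeasureTheory

attribute [summit_statement] _root_.KontsevichZagierPeriods

open Literature Periods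

/-- item stmt-KontsevichZagierPeriods-3903 · crux (kind.auto-crux: conjecture-grade) · rank 0 · open · by planner
why it might fail: Equivalent to KZKernelConjecture for unconstrained L, hence at least as strong as the summit; the intended instance KZlog may be too small a calculus (regularised Stokes with semialgebraic primitives only) for RegKernel.
sources: DupontPanzerPym2026, KontsevichZagier2001, HuberMullerStach2017
[target] typed shell of X: there is an additive "regularised calculus" (L, rel, ev) over
KZ.FormalRep with a section ι and a retraction Λ (Λ∘ι = id, ev∘ι = eval) such that ker ev ≤ rel
(RegKernel) and Λ(rel) ≤ KZ.relations (RegConservative). For unconstrained L this is equivalent to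
`Literature.NumberTheory.Transcendental.KZKernelConjecture` (take L := FormalRep; `shell_of_kernel`
in Sketch.lean); the route's content is the INSTANCE L := KZlog.FormalRep (definition request) — do
not attack the shell directly; it is closed by RegKernel ∧ RegConservative for KZlog (informal
cruxes filed after open). -/
@[route_item "route-KontsevichZagierPeriods-Deregularisation", crux]
def DeregularisationShell : Prop :=
  ∃ (L : Type) (_ : AddCommGroup L) (rel : AddSubgroup L) (ev : L →+ ℝ) (ι : Literature.NumberTheory.Transcendental.KZ.FormalRep →+ L) (Λ : L →+ Literature.NumberTheory.Transcendental.KZ.FormalRep), (∀ c, Λ (ι c) = c) ∧ (∀ c, ev (ι c) = Literature.NumberTheory.Transcendental.KZ.eval c) ∧ (∀ d, ev d = 0 → d ∈ rel) ∧ (∀ d ∈ rel, Λ d ∈ Literature.NumberTheory.Transcendental.KZ.relations)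

/-- item stmt-KontsevichZagierPeriods-3904 · crux · rank 2 · open · by planner
why it might fail: All printed proofs expand Σ_{N≥M} 1/(MN³) in series or integrate by parts with polylog primitives (fibre primitive −log(1−xyz)/(yz): barrier noSemialgebraicPrimitive); a finite chain in (0,1)⁴ may not exist — then an additive invariant separating A from B refutes the summit.
sources: IharaKanekoZagier2006, Hoffman1992, DupontPanzerPym2026, Souderes2010, Literature.Barriers.KontsevichZagierPeriods.noSemialgebraicPrimitive_inv_sub_two
[crux] the Λ-defect of the shear (u,x) ↦ (u,ux) in the de-regularised IKZ derivation for ζ(1)·ζ(3):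
the rational reps A = [{(u,x,y,z) ∈ (0,1)⁴ : u < x}, 1/((1−u)(1−xyz))] and B = [(0,1)⁴,
1/((1−uxyz)(1−xyz))] (both absolutely convergent, both of value Σ_N H_N/N³ = ζ(4)+ζ(3,1) = 5ζ(4)/4)
are KZ-equivalent. Modulo eight bookkeeping moves (DefectToHoffman) this IS Hoffman's weight-4
relation; card items (d) Λ∘CoV − CoV∘Λ and (e) calibration. [difficulty: L] -/
@[route_item "route-KontsevichZagierPeriods-Deregularisation"]
def ScalingDefectWeightFour : Prop :=
  ∀ (r r' : Literature.NumberTheory.Transcendental.KZ.IntegralRep 4), r.domain = {t | (∀ i, t i ∈ Set.Ioo (0:ℝ) 1) ∧ t 0 < t 1} → Set.EqOn r.integrand (fun t => 1 / ((1 - t 0) * (1 - t 1 * t 2 * t 3))) r.domain → r'.domain = {t | ∀ i, t i ∈ Set.Ioo (0:ℝ) 1} → Set.EqOn r'.integrand (fun t => 1 / ((1 - t 0 * t 1 * t 2 * t 3) * (1 - t 1 * t 2 * t 3))) r'.domain → Literature.NumberTheory.Transcendental.KZ.Equivalent r r'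

/-- item stmt-KontsevichZagierPeriods-3905 · crux · rank 3 · open · by planner
why it might fail: Uniform proof exists only where G has a semialgebraic x₁-primitive (two Newton–Leibniz moves); from G = 1/(1−x₁⋯xₙ) on it contains every Hoffman-type relation; a single L¹ counterexample (additive invariant) kills it and the summit together.
sources: DupontPanzerPym2026, IharaKanekoZagier2006, BrownKreimer2013, KontsevichZagier2001
[crux] RegConservative on shears, typed: for every G ∈ L¹((0,1)^{n+1}), A_G = [{u < x₁} × (0,1)^n,
G(x)/(1−u)] and B_G = [(0,1)^{n+2}, (G(x) − u·G(u x₁, x₂, …))/(1−u)] are KZ-equivalent whenever both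
are integral representations (values agree by Fubini; G ∈ L¹ is necessary: G = 1/x₁ gives ζ(2)
versus 0, the Dupont–Panzer–Pym anomaly ∫ log u du/(1−u)). With G = Soudères' cubical MZV integrand
f_s this family is IKZ's "EDS with ζ(1)" (Thm 2 (v), m = 1), which with finite double shuffle
conjecturally exhausts all MZV relations (IKZ statement (3), checked to weight 16). [deps:
ScalingDefectWeightFour] [difficulty: open-problem] -/
@[route_item "route-KontsevichZagierPeriods-Deregularisation"]
def ScalingDefectPrinciple : Prop :=
  ∀ (n : ℕ) (G : (Fin (n + 1) → ℝ) → ℝ) (r r' : Literature.NumberTheory.Transcendental.KZ.IntegralRep (n + 2)), MeasureTheory.IntegrableOn G {x | ∀ i, x i ∈ Set.Ioo (0:ℝ) 1} → r.domain = {t | (∀ i, t i ∈ Set.Ioo (0:ℝ) 1) ∧ t 0 < t 1} → Set.EqOn r.integrand (fun t => G (Fin.tail t) / (1 - t 0)) r.domain → r'.domain = {t | ∀ i, t i ∈ Set.Ioo (0:ℝ) 1} → Set.EqOn r'.integrand (fun t => (G (Fin.tail t) - t 0 * G (Function.update (Fin.tail t) 0 (t 0 * t 1))) / (1 - t 0))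 r'.domain → Literature.NumberTheory.Transcendental.KZ.Equivalent r r'

/-- item stmt-KontsevichZagierPeriods-3906 · crux · rank 4 · open · by planner
why it might fail: Known proofs use ζ(1)-regularisation (IKZ Thm 1), Euler's evaluations through π, or series rearrangement (Hoffman 1992 Thm 5.1, sum formula); equivalent mod bookkeeping to ScalingDefectWeightFour, so it stands or falls with the shear defect unless a π-detour chain exists.
sources: Hoffman1992, IharaKanekoZagier2006, Souderes2010, Brown2012, KontsevichZagier2001
[crux] Hoffman's relation in weight 4 inside the calculus: for the simplex reps Z4 = [Δ⁴, ω₀ω₀ω₀ω₁],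
Z31 = [Δ⁴, ω₀ω₀ω₁ω₁], Z22 = [Δ⁴, ω₀ω₁ω₀ω₁] (same domain literal as Grothendieck 0275), [Z4] − [Z31]
− [Z22] ∈ KZ.relations. The smallest MZV relation born from regularisation: not in the ℚ-span of
finite double shuffle + duality (weight 4: five symbols, three relations, true dimension 1; IKZ
§2–3); card calibration (e). [deps: ScalingDefectWeightFour] [difficulty: L] -/
@[route_item "route-KontsevichZagierPeriods-Deregularisation"]
def HoffmanWeightFour : Prop :=
  ∀ (r₁ r₂ r₃ : Literature.NumberTheory.Transcendental.KZ.IntegralRep 4), r₁.domain = {t | 1 > t 0 ∧ t 0 > t 1 ∧ t 1 > t 2 ∧ t 2 > t 3 ∧ t 3 > 0} → Set.EqOn r₁.integrand (fun t => 1 / (t 0 * t 1 * t 2 * (1 - t 3))) r₁.domain → r₂.domain = r₁.domain → Set.EqOn r₂.integrand (fun t => 1 / (t 0 * t 1 * (1 - t 2) * (1 - t 3))) r₂.domain → r₃.domain = r₁.domain → Set.EqOn r₃.integrand (fun t => 1 / (t 0 * (1 - t 1) * t 2 * (1 - t 3))) r₃.domain → Literature.NumberTheory.Transcendental.KZ.of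 r₁ - Literature.NumberTheory.Transcendental.KZ.of r₂ - Literature.NumberTheory.Transcendental.KZ.of r₃ ∈ Literature.NumberTheory.Transcendental.KZ.relations

/-- item stmt-KontsevichZagierPeriods-4952 · crux · rank 5 · open · by planner
why it might fail: Shear defects already carry genuine MZV relations (Hoffman at weight 4); for depth >= 2 corners the subtraction scheme is not canonical; regularised Stokes may need primitives with log/phantom terms outside the semialgebraic class (barrier noSemialgebraicPrimitive).
sources: DupontPanzerPym2026, BrownKreimer2013, IharaKanekoZagier2006, KontsevichZagier2001
[crux] RegConservative (X1; needs definition KZreg + Λ, request filed): for every c ∈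
KZreg.relations, Λ c ∈ Literature.NumberTheory.Transcendental.KZ.relations, and Λ ∘ incl = id on
convergent reps (DPP Prop 7.15: absolutely convergent ⇒ regularised integral = ordinary integral, no
divergence face ⇒ tangential datum irrelevant). Λ = stratified finite part by product-collar
subtraction with zero extension off the domain, plus explicit anomaly reps ∫dv/v for changes of
tangential data (n = 1: Λ(reg∫₀¹ f dx/x) = [(0,1), (f(x)−f(0))/x]). STATUS after this session's hand
computation (NOTES.md of the opening planner): conservative BY BOOKKEEPING on integrand additivity
(Λ is linear in the integrand), on domain additivity inside one chart, and on u-independent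
(product) changes of variables; the 1-dim anomaly is paid by moves (support AnomalyDimOne); the
ENTIRE residual content on the Ihara–Kaneko–Zagier ζ(1)·ζ(s) derivations is the u-dependent shear x₁
↦ u·x₁ of the corner chart, whose Λ-defect is the typed family ScalingDefectPrinciple (rank 3;
weight-4 instance rank 2). What remains beyond shears: (i) well-definedness = independence of the
collar/chart modulo KZ.relations for deeper c -/
@[route_item "route-KontsevichZagierPeriods-Deregularisation"]
def RegConservative2 : Prop :=
  Literature.NumberTheory.Transcendental.KZreg.Conservative

-- item stmt-KontsevichZagierPeriods-4953 · crux · rank 6 · open · by planner — informal only, no Lean statement yet: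
--   [crux] EDSInKZreg (literature-level crux; needs KZreg and a formalisation of IKZ's regularised
--   double shuffle): every extended double-shuffle relation of Ihara–Kaneko–Zagier
--   (IharaKanekoZagier2006 Thm 1: Z_k^ш(T) = ρ(Z_k^*(T)) for all index sets k; equivalently Thm 2
--   (i)–(v)), written for simplex/cubical log-corner representations of the divergent words with
--   Deligne's tangential base points ∂/∂t at 0 and 1, is a KZreg-relation, i.e. a finite chain of DPP
--   moves (additivity, change of variables with anomaly, regularised Stokes) with ℚ-semialgebraic data.
--   For the part linear in T (EDS with ζ(1),

-- earlier RegKernel2 (stmt-KontsevichZagierPeriods-4954, replaced 2026-08-16T03:28:44Z -> stmt-KontsevichZagierPeriods-14491): retired by None — ∀ d : Literature.NumberTheory.Transcendental.KZreg.FormalRep, Literature.NumberTheory.Transcendental.KZreg.eval d = 0 → d ∈ Literature.NumberTheory.Transcendental.KZreg.relations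
/-- item stmt-KontsevichZagierPeriods-14491 · crux · rank 9 · open · by planner
why it might fail: Summit-strength: with RegConservative2 it is Conjecture 1 (proved iff), alone implied by it. False iff a vanishing Z-combination of convergent Q-semialgebraic integrals is unreachable even via regularised log-corner detours (e.g. a modular/hypergeometric identity; route Neg).
sources: DupontPanzerPym2026, KontsevichZagier2001, HuberMullerStach2017, IharaKanekoZagier2006, Literature.NumberTheory.Transcendental.KZreg.not_kernelConjecture, Literature.NumberTheory.Transcendental.KZreg.conservative_and_ker_le_iff
[crux] RegKernel2 REPAIRED (route-repair 2026-08-16). The v1 shape `∀ d, KZreg.eval d = 0 → d ∈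
KZreg.relations` (= KZreg.KernelConjecture) is REFUTED in tree (`KZreg.not_kernelConjecture`,
KZRegCalculusProofs.lean: the unit pole [(0,1), dt/(1−t); D={0}] has regularised value 0 but residue
value 1, and the four v1 moves preserve the residue functional `KZreg.res` — v1 has no move paying a
pure divergence; DPP obtain reg∫dr/r = log(a/λ) only by regularised Stokes ACROSS the divergence
face / change of scale, Ex. 7.13, not moves of v1). Repaired X2 = COMPLETENESS OF DE-REGULARISED
MOVE CHAINS: every vanishing ℤ-combination c of ordinary KZ representations is the de-regularisation
Λ d of a relation d of the regularised calculus, ker KZ.eval ≤ Λ(KZreg.relations). Kernel-checked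
equivalent readings (repair seat's Sketch.lean, attached as evidence on stmt-4954): ⟺ ∀ d,
KZreg.eval d = 0 → d ∈ KZreg.relations ⊔ ker Λ ⟺ KZreg.eval.ker ≤ KZreg.relations ⊔ KZreg.defects
(the refuter's repaired C′ of rattack-4954; ker Λ = defects), i.e. the kernel statement of the
calculus in which each representation is identified with the inclusion of its finite part. PROVED
there: KontsevichZagierPeriods → -/
@[route_item "route-KontsevichZagierPeriods-Deregularisation"]
def RegKernel2 : Prop :=
  ∀ c : Literature.NumberTheory.Transcendental.KZ.FormalRep, Literature.NumberTheory.Transcendental.KZ.eval c = 0 → ∃ d ∈ Literature.NumberTheory.Transcendental.KZreg.relations, Literature.NumberTheory.Transcendental.KZreg.Λ d = c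

/-- item stmt-KontsevichZagierPeriods-14296 · support · rank 9 · closed · proved by Summit.KontsevichZagierPeriods.Deregularisation.shellOfKZreg_proof @ e9f37d5df3bd (prover) · by planner
sources: DupontPanzerPym2026, KontsevichZagier2001
[support] glue (route-choice repair, target-unreachable): the two KZreg cruxes instantiate the typed
shell — take L := KZreg.FormalRep, rel := KZreg.relations, ev := KZreg.eval (DPP regularised value),
ι := KZreg.incl, Λ := KZreg.Λ (de-regularisation); Λ∘ι = id is `KZreg.Λ_incl`, ev∘ι = KZ.eval is
`KZreg.eval_incl` (both proved in Literature/NumberTheory/Transcendental/KZRegCalculus.lean), ker ev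
≤ rel is RegKernel2 (= KZreg.KernelConjecture) and Λ(rel) ≤ KZ.relations is RegConservative2 (=
KZreg.Conservative). A ten-line term proof (anonymous-constructor on the ∃); mirrors
`KZreg.kzKernelConjecture_of_conservative`. With it the target DeregularisationShell — hence, by the
deciding theorem `closes`, the summit — is reached from the route's own cruxes. [glue] [deps:
RegConservative2, RegKernel2] [difficulty: XS] -/
@[route_item "route-KontsevichZagierPeriods-Deregularisation"]
def ShellOfKZreg : Prop :=
  RegConservative2 → RegKernel2 → DeregularisationShell

/-- item stmt-KontsevichZagierPeriods-3907 · support · rank 9 · open · by planner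
sources: Souderes2010, KontsevichZagier2001
[support] the bookkeeping half of the de-regularised IKZ derivation at weight 4, all on convergent
reps: A ≡ Z22 + 2·Z31 (cubical-to-simplicial change of variables (u,x,y,z) ↦ (u,x,xy,xyz), domain
additivity of {u < s₁} by the position of u, three coordinate permutations) and B ≡ Z31 + Z4
(integrand additivity 1/((1−uw)(1−w)) = w/((1−w)(1−uw)) + 1/(1−uw), w = xyz, Soudères' Prop. 1.3
changes of variables); hence ScalingDefectWeightFour → HoffmanWeightFour. Lean-heavy (side
conditions of ~8 move instances), no new idea. [difficulty: L] -/
@[route_item "route-KontsevichZagierPeriods-Deregularisation"]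
def DefectToHoffman : Prop :=
  ScalingDefectWeightFour → HoffmanWeightFour

/-- item stmt-KontsevichZagierPeriods-3908 · support · rank 9 · open · by planner
sources: DupontPanzerPym2026, KontsevichZagier2001
[support] the one-dimensional Dupont–Panzer–Pym anomaly is paid by moves: for f continuous at 0⁺ and
a ℚ-semialgebraic strictly increasing φ : [0,1] → [0,1], φ(0)=0, φ(1)=1, differentiable on (0,1),
right derivative c > 0 at 0, the finite parts Λ(reg∫₀¹ f dx/x) = [(0,1), (f(x)−f(0))/x] and Λ of its
φ-reparametrisation [(0,1), f(φ(y))φ'(y)/φ(y) − f(0)/y] differ in KZ.relations exactly by the log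
rep [(0,1), f(0)(c−1)/(1+(c−1)v)] (value f(0)·log c). Expected chain: change of variables x = φ(y),
integrand additivity, then [(0,1), f(0)ψ'/ψ] with ψ = φ(y)/y ↦ change of variables z = ψ(y) on
monotonicity cells of ψ (o-minimal cell decomposition), domain additivity. [difficulty: M] -/
@[route_item "route-KontsevichZagierPeriods-Deregularisation"]
def AnomalyDimOne : Prop :=
  ∀ (f φ φ' : ℝ → ℝ) (c : ℝ) (r₁ r₂ r₃ : Literature.NumberTheory.Transcendental.KZ.IntegralRep 1), 0 < c → φ 0 = 0 → φ 1 = 1 → StrictMonoOn φ (Set.Icc 0 1) → ContinuousOn φ (Set.Icc 0 1) → Literature.NumberTheory.Transcendental.IsSemialgebraicFunOn ℚ {t : Fin 1 → ℝ | t 0 ∈ Set.Ioo (0:ℝ) 1} (fun t => φ (t 0)) → (∀ y ∈ Set.Ioo (0:ℝ) 1, HasDerivAt φ (φ' y) y) → HasDerivWithinAt φ c (Set.Ici 0) 0 → ContinuousWithinAt f (Set.Ici 0) 0 → r₁.domain = {t | t 0 ∈ Set.Ioo (0:ℝ) 1} → Set.EqOn r₁.integrand (fun t => (f (t 0) - f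 0) / t 0) r₁.domain → r₂.domain = {t | t 0 ∈ Set.Ioo (0:ℝ) 1} → Set.EqOn r₂.integrand (fun t => f (φ (t 0)) * φ' (t 0) / φ (t 0) - f 0 / t 0) r₂.domain → r₃.domain = {t | t 0 ∈ Set.Ioo (0:ℝ) 1} → Set.EqOn r₃.integrand (fun t => f 0 * (c - 1) / (1 + (c - 1) * t 0)) r₃.domain → Literature.NumberTheory.Transcendental.KZ.of r₂ - Literature.NumberTheory.Transcendental.KZ.of r₁ + Literature.NumberTheory.Transcendental.KZ.of r₃ ∈ Literature.NumberTheory.Transcendental.KZ.relations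

/-- item stmt-KontsevichZagierPeriods-3909 · assembly · rank 1 · closed · proved by Summit.KontsevichZagierPeriods.Deregularisation.assembly_proof @ 71d4d39983ab (prover) · by planner
sources: KontsevichZagier2001, DupontPanzerPym2026
[assembly] DeregularisationShell → KontsevichZagierPeriods. -/
@[route_item "route-KontsevichZagierPeriods-Deregularisation"]
def Assembly : Prop :=
  DeregularisationShell → KontsevichZagierPeriods

/-! D-0027 §2.1 — DECIDING THEOREM (planner-authored via `route open/edit --closes-file`; by planner-rbadge-KontsevichZagierPeriods-Deregul-c9ee0eed-g2-0 2026-08-15T16:12:09Z):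
its hypotheses are this route's items and its conclusion the sub-problem Statement (glue_lint), and it elaborates with this file. -/

@[closes "route-KontsevichZagierPeriods-Deregularisation"] theorem closes (h : DeregularisationShell) : KontsevichZagierPeriods := by
  intro n m r r' _ _ hval
  obtain ⟨L, _, rel, ev, ι, Λ, hΛι, hev, hker, hcons⟩ := h
  have h0 : ev (ι (Literature.NumberTheory.Transcendental.KZ.of r -
      Literature.NumberTheory.Transcendental.KZ.of r')) = 0 := by
    rw [hev, map_sub, Literature.NumberTheory.Transcendental.KZ.eval_of,
      Literature.NumberTheory.Transcendental.KZ.eval_of, hval, sub_self]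
  have h1 := hcons _ (hker _ h0)
  rw [hΛι] at h1
  exact h1

end Summit.KontsevichZagierPeriods.KontsevichZagierPeriods.Theses.Deregularisation
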